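import Literature.Probability.Percolation.KSTPeriodicStatements
import Literature.Probability.Percolation.RSWProofs
import HarnessLib

/-!
# KST-type RSW for periodic measures: Lemma 4, the walk combinatorics

Topic `Literature/Probability/Percolation`. First half of the proof of
[KohlerSchindlerTassion2023, Lemma 4 and Comment 1] (cascading of quasi-crossings) in the
constant, positive-scale form `CascadeStepPos` of `KSTPeriodicStatements.lean`.

Write `b = l/12`, `H_l = R_t(l + b, l)` (the region of `l`-paths) and let `𝓔` be the increasing
event "some open walk inside `H_l` from the upper to the lower target of `H_l` has no sub-walk
(by edges) inside `H_j` joining the targets of `H_j`" — the discrete rendering of "an open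
`l`-path containing no `j`-path".

* `measurableSet_exists_openWalk`, `isUpperSet_exists_openWalk`: events "some lattice walk with a
  given property is open" are measurable and increasing.
* `exists_walk_of_mPathAt`, `mPathAt_of_subwalk`: `m`-paths as open lattice walks and back.
* `quasi_subset_quasi_or_noSubpath`: `𝓠(m, l) ⊆ 𝓠(m, j) ∪ 𝓔` for lattice configurations.
* `openConnIn_left_box`, `openConnIn_right_box`: cutting a crossing of a narrower box out of a
  connection to a side column (first/last visit to a column, `exists_openConnIn_column(_ge)`).

## References

* [KohlerSchindlerTassion2023] L. Köhler-Schindler, V. Tassion, *Crossing probabilities for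
  planar percolation*, Duke Math. J. 172 (2023), §4.4, Lemma 4; Comment 1.
-/

namespace Literature.Probability.Percolation

open LatticeModels SimpleGraph MeasureTheory

noncomputable section

namespace KSTPeriodic

/-! ### Events "some open lattice walk with a given property" -/

/-- The event that some lattice walk with property `Good` is open is measurable: it is the
countable union over finite edge sets `F` of the cylinder `{F ⊆ ω}` (intersected with the
constant event that `F` is the edge set of a good walk). [folklore] -/
theorem measurableSet_exists_openWalk (Good : ∀ p q : Site 2, (zdGraph 2).Walk p q → Prop) :
    MeasurableSet {ω : BondConfig (Site 2) |
      ∃ (p q : Site 2) (P : (zdGraph 2).Walk p q), Good p q P ∧ ∀ e ∈ P.edges, e ∈ ω} := by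
  classical
  have hEq : {ω : BondConfig (Site 2) |
      ∃ (p q : Site 2) (P : (zdGraph 2).Walk p q), Good p q P ∧ ∀ e ∈ P.edges, e ∈ ω} =
      ⋃ F : Finset (Sym2 (Site 2)), (⋂ e ∈ F, {ω : BondConfig (Site 2) | e ∈ ω}) ∩
        {_ω | ∃ (p q : Site 2) (P : (zdGraph 2).Walk p q), Good p q P ∧ P.edges.toFinset = F} := by
    ext ω
    simp only [Set.mem_setOf_eq, Set.mem_iUnion, Set.mem_inter_iff, Set.mem_iInter]
    constructor
    · rintro ⟨p, q, P, hG, hP⟩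
      exact ⟨P.edges.toFinset, fun e he => hP e (List.mem_toFinset.1 he), p, q, P, hG, rfl⟩
    · rintro ⟨F, hF, p, q, P, hG, rfl⟩
      exact ⟨p, q, P, hG, fun e he => hF e (List.mem_toFinset.2 he)⟩
  rw [hEq]
  refine MeasurableSet.iUnion fun F => MeasurableSet.inter ?_ (MeasurableSet.const _)
  exact Finset.measurableSet_biInter F fun e _ => measurableSet_mem e

/-- The event that some lattice walk with property `Good` is open is increasing. [folklore] -/
theorem isUpperSet_exists_openWalk (Good : ∀ p q : Site 2, (zdGraph 2).Walk p q → Prop) :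
    IsUpperSet {ω : BondConfig (Site 2) |
      ∃ (p q : Site 2) (P : (zdGraph 2).Walk p q), Good p q P ∧ ∀ e ∈ P.edges, e ∈ ω} := by
  rintro ω ω' hle ⟨p, q, P, hG, hP⟩
  exact ⟨p, q, P, hG, fun e he => hle (hP e he)⟩

/-! ### `m`-paths as walks -/

/-- For a lattice configuration, a vertex on an open `m`-path lies on an open lattice walk inside
`H = R_t(m + b, m)` from the upper target to the lower target. [cite: KohlerSchindlerTassion2023, §4.1] -/
theorem exists_walk_of_mPathAt {ω : BondConfig (Site 2)} (hω : ω ⊆ (zdGraph 2).edgeSet)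
    {t b m : ℕ} {z : Site 2} (h : MPathAt t b m ω z) :
    ∃ (u v : Site 2) (P : (zdGraph 2).Walk u v), u ∈ upperTarget t b m ∧
      v ∈ upperTarget t b (-(m : ℤ) - t) ∧ (∀ x ∈ P.support, x ∈ mRegion t b m) ∧
      (∀ e ∈ P.edges, e ∈ ω) ∧ z ∈ P.support := by
  classical
  obtain ⟨⟨u, hu, hzu⟩, ⟨v, hv, hzv⟩⟩ := h
  obtain ⟨A, hAS, hAω⟩ := exists_walk_of_mem_openConnIn hω hzu
  obtain ⟨B, hBS, hBω⟩ := exists_walk_of_mem_openConnIn hω hzv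
  refine ⟨u, v, A.reverse.append B, hu, hv, ?_, ?_, ?_⟩
  · intro x hx
    rw [Walk.mem_support_append_iff, Walk.support_reverse, List.mem_reverse] at hx
    rcases hx with hx | hx
    · exact hAS x hx
    · exact hBS x hx
  · intro e he
    rw [Walk.edges_append, List.mem_append, Walk.edges_reverse, List.mem_reverse] at he
    rcases he with he | he
    · exact hAω e he
    · exact hBω e he
  · rw [Walk.mem_support_append_iff, Walk.support_reverse, List.mem_reverse]
    exact Or.inl A.start_mem_support

/-- A sub-walk (by edges) inside `H_j` between the targets of `H_j` of an open walk is an open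
`j`-path through its starting point, and that starting point is a vertex of the big walk (the
targets are distinct rows since `0 < j`). [cite: KohlerSchindlerTassion2023, §4.4] -/
theorem mPathAt_of_subwalk {ω : BondConfig (Site 2)} {t bj j : ℕ} (hj : 0 < j) {u v : Site 2}
    {P : (zdGraph 2).Walk u v} (hPω : ∀ e ∈ P.edges, e ∈ ω) {p q : Site 2}
    (κ : (zdGraph 2).Walk p q) (hp : p ∈ upperTarget t bj j) (hq : q ∈ upperTarget t bj (-(j : ℤ) - t))
    (hκS : ∀ x ∈ κ.support, x ∈ mRegion t bj j) (hκP : ∀ e ∈ κ.edges, e ∈ P.edges) :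
    MPathAt t bj j ω p ∧ p ∈ P.support := by
  have hpS : p ∈ mRegion t bj j := hκS p κ.start_mem_support
  refine ⟨⟨⟨p, hp, openConnIn_refl hpS⟩, ⟨q, hq, mem_openConnIn_of_walk κ hκS
    fun e he => hPω e (hκP e he)⟩⟩, ?_⟩
  -- `κ` has an edge at `p`
  cases κ with
  | nil =>
    exfalso
    rw [mem_upperTarget] at hp hq
    omega
  | cons hadj κ' =>
    rename_i w
    have he : s(p, w) ∈ P.edges := hκP _ (by simp [Walk.edges_cons])
    exact Walk.fst_mem_support_of_mem_edges P he

/-! ### Part 1: `𝓠(m, l) ⊆ 𝓠(m, j) ∪ 𝓔` -/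

/-- One side of Part 1: if the `l`-path through the anchor `z` of a half quasi-crossing admits a
`j`-sub-walk `κ`, the start of `κ` is the anchor of a half quasi-crossing down to scale `j`
(same side point `x₀`, same big box `S ⊇ H_l`). [cite: KohlerSchindlerTassion2023, §4.4] -/
theorem quasiSide_of_subwalk {ω : BondConfig (Site 2)} {t bj j : ℕ} (hj : 0 < j)
    {S H : Set (Site 2)} (hHS : H ⊆ S) {u v : Site 2} {P : (zdGraph 2).Walk u v}
    (hPS : ∀ x ∈ P.support, x ∈ H) (hPω : ∀ e ∈ P.edges, e ∈ ω) {z x₀ : Site 2}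
    (hz : z ∈ P.support) (hzx : ω ∈ openConnIn S z x₀) {p q : Site 2}
    (κ : (zdGraph 2).Walk p q) (hp : p ∈ upperTarget t bj j) (hq : q ∈ upperTarget t bj (-(j : ℤ) - t))
    (hκS : ∀ x ∈ κ.support, x ∈ mRegion t bj j) (hκP : ∀ e ∈ κ.edges, e ∈ P.edges) :
    MPathAt t bj j ω p ∧ ω ∈ openConnIn S p x₀ := by
  classical
  obtain ⟨hM, hpP⟩ := mPathAt_of_subwalk hj hPω κ hp hq hκS hκP
  refine ⟨hM, ?_⟩
  have h1 : ω ∈ openConnIn S u p :=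
    openConnIn_mono hHS _ _ (mem_openConnIn_of_mem_support P hPS hPω hpP)
  have h2 : ω ∈ openConnIn S u z :=
    openConnIn_mono hHS _ _ (mem_openConnIn_of_mem_support P hPS hPω hz)
  rw [openConnIn_comm] at h1
  exact PlanarDuality.openConnIn_trans (PlanarDuality.openConnIn_trans h1 h2) hzx

/-- **Part 1 of Lemma 4**: for a lattice configuration, `𝓠(m, l) ⊆ 𝓠(m, j) ∪ 𝓔` (`j ≤ l ≤ m`,
`0 < j`): the `l`-paths through the two anchors of the quasi-crossing either both admit
`j`-sub-walks — whose starting points anchor a quasi-crossing down to scale `j` — or one of them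
witnesses `𝓔`. [cite: KohlerSchindlerTassion2023, Lemma 4 (first display)] -/
theorem quasi_subset_quasi_or_noSubpath {ω : BondConfig (Site 2)} (hω : ω ⊆ (zdGraph 2).edgeSet)
    {t w m l j : ℕ} (hj : 0 < j) (hlm : l ≤ m) (hw : l / 12 ≤ w)
    (hQ : ω ∈ quasi t w m (l / 12) l) :
    ω ∈ quasi t w m (j / 12) j ∨
      ∃ (p q : Site 2) (P : (zdGraph 2).Walk p q),
        (p ∈ upperTarget t (l / 12) l ∧ q ∈ upperTarget t (l / 12) (-(l : ℤ) - t) ∧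
          (∀ x ∈ P.support, x ∈ mRegion t (l / 12) l) ∧
          ¬ ∃ (p' q' : Site 2) (κ : (zdGraph 2).Walk p' q'),
            p' ∈ upperTarget t (j / 12) j ∧ q' ∈ upperTarget t (j / 12) (-(j : ℤ) - t) ∧
            (∀ x ∈ κ.support, x ∈ mRegion t (j / 12) j) ∧ ∀ e ∈ κ.edges, e ∈ P.edges) ∧
        ∀ e ∈ P.edges, e ∈ ω := by
  classical
  obtain ⟨⟨z₁, hM₁, x₁, hx₁, hx₁c, hc₁⟩, ⟨z₂, hM₂, x₂, hx₂, hx₂c, hc₂⟩⟩ := hQ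
  have hHS : mRegion t (l / 12) l ⊆ rect (-((m : ℤ) + w) - t) (m + w) (-(m : ℤ) - t) m := by
    intro x hx
    simp only [mRegion, mem_rect] at hx ⊢
    have h1 : ((l / 12 : ℕ) : ℤ) ≤ w := by exact_mod_cast hw
    have h2 : (l : ℤ) ≤ m := by exact_mod_cast hlm
    omega
  obtain ⟨u₁, v₁, P₁, hu₁, hv₁, hP₁S, hP₁ω, hz₁⟩ := exists_walk_of_mPathAt hω hM₁
  obtain ⟨u₂, v₂, P₂, hu₂, hv₂, hP₂S, hP₂ω, hz₂⟩ := exists_walk_of_mPathAt hω hM₂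
  by_cases h₁ : ∃ (p' q' : Site 2) (κ : (zdGraph 2).Walk p' q'),
      p' ∈ upperTarget t (j / 12) j ∧ q' ∈ upperTarget t (j / 12) (-(j : ℤ) - t) ∧
      (∀ x ∈ κ.support, x ∈ mRegion t (j / 12) j) ∧ ∀ e ∈ κ.edges, e ∈ P₁.edges
  swap
  · exact Or.inr ⟨u₁, v₁, P₁, ⟨hu₁, hv₁, hP₁S, h₁⟩, hP₁ω⟩
  by_cases h₂ : ∃ (p' q' : Site 2) (κ : (zdGraph 2).Walk p' q'),
      p' ∈ upperTarget t (j / 12) j ∧ q' ∈ upperTarget t (j / 12) (-(j : ℤ) - t) ∧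
      (∀ x ∈ κ.support, x ∈ mRegion t (j / 12) j) ∧ ∀ e ∈ κ.edges, e ∈ P₂.edges
  swap
  · exact Or.inr ⟨u₂, v₂, P₂, ⟨hu₂, hv₂, hP₂S, h₂⟩, hP₂ω⟩
  left
  obtain ⟨p₁, q₁, κ₁, hp₁, hq₁, hκ₁S, hκ₁P⟩ := h₁
  obtain ⟨p₂, q₂, κ₂, hp₂, hq₂, hκ₂S, hκ₂P⟩ := h₂
  obtain ⟨hMp₁, hcp₁⟩ := quasiSide_of_subwalk hj hHS hP₁S hP₁ω hz₁ hc₁ κ₁ hp₁ hq₁ hκ₁S hκ₁P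
  obtain ⟨hMp₂, hcp₂⟩ := quasiSide_of_subwalk hj hHS hP₂S hP₂ω hz₂ hc₂ κ₂ hp₂ hq₂ hκ₂S hκ₂P
  exact ⟨⟨p₁, hMp₁, x₁, hx₁, hx₁c, hcp₁⟩, ⟨p₂, hMp₂, x₂, hx₂, hx₂c, hcp₂⟩⟩

/-! ### Part 2: `𝓔 ∩ 𝓠(l, j)` forces a translated bridge -/

/-- Cutting a crossing out of a connection to the left column: if `p` (with `p₀ ≤ X`) is joined
inside `[L, R] × [B, T]` to a point `e` of the left column, then `e` is joined inside
`[L, X] × [B, T]` to `p` or to a point of the column `X` (first visit to the column `X` seen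
from `e`). [folklore] -/
theorem openConnIn_left_box {ω : BondConfig (Site 2)} (hω : ω ⊆ (zdGraph 2).edgeSet)
    {L R B T X : ℤ} (hLX : L ≤ X) {p e : Site 2} (he : e 0 = L)
    (h : ω ∈ openConnIn (rect L R B T) p e) :
    ∃ y : Site 2, (y = p ∨ y 0 = X) ∧ y ∈ rect L X B T ∧ ω ∈ openConnIn (rect L X B T) e y := by
  classical
  obtain ⟨ξ, hξS, hξω⟩ := exists_walk_of_mem_openConnIn hω h
  by_cases hall : ∀ z ∈ ξ.support, z 0 ≤ X
  · have hS : ∀ z ∈ ξ.support, z ∈ rect L X B T := fun z hz =>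
      ⟨(hξS z hz).1, hall z hz, (hξS z hz).2.2.1, (hξS z hz).2.2.2⟩
    refine ⟨p, Or.inl rfl, hS p ξ.start_mem_support, ?_⟩
    rw [openConnIn_comm]
    exact mem_openConnIn_of_walk ξ hS hξω
  · push Not at hall
    obtain ⟨z, hz, hzX⟩ := hall
    have h1 : ω ∈ openConnIn (rect L R B T) e z := by
      rw [openConnIn_comm] at h
      exact PlanarDuality.openConnIn_trans h (mem_openConnIn_of_mem_support ξ hξS hξω hz)
    obtain ⟨y, hy, hey⟩ := exists_openConnIn_column hω X (by omega) hzX.le h1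
    have hsub : rect L R B T ∩ {z : Site 2 | z 0 ≤ X} ⊆ rect L X B T :=
      fun w hw => ⟨hw.1.1, hw.2, hw.1.2.2.1, hw.1.2.2.2⟩
    have hey' := openConnIn_mono hsub _ _ hey
    exact ⟨y, Or.inr hy, hey'.2.1, hey'⟩

/-- Mirror image of `openConnIn_left_box` for a connection to the right column. [folklore] -/
theorem openConnIn_right_box {ω : BondConfig (Site 2)} (hω : ω ⊆ (zdGraph 2).edgeSet)
    {L R B T X : ℤ} (hXR : X ≤ R) {p e : Site 2} (he : e 0 = R)
    (h : ω ∈ openConnIn (rect L R B T) p e) :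
    ∃ y : Site 2, (y = p ∨ y 0 = X) ∧ y ∈ rect X R B T ∧ ω ∈ openConnIn (rect X R B T) e y := by
  classical
  obtain ⟨ξ, hξS, hξω⟩ := exists_walk_of_mem_openConnIn hω h
  by_cases hall : ∀ z ∈ ξ.support, X ≤ z 0
  · have hS : ∀ z ∈ ξ.support, z ∈ rect X R B T := fun z hz =>
      ⟨hall z hz, (hξS z hz).2.1, (hξS z hz).2.2.1, (hξS z hz).2.2.2⟩
    refine ⟨p, Or.inl rfl, hS p ξ.start_mem_support, ?_⟩
    rw [openConnIn_comm]
    exact mem_openConnIn_of_walk ξ hS hξω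
  · push Not at hall
    obtain ⟨z, hz, hzX⟩ := hall
    have h1 : ω ∈ openConnIn (rect L R B T) e z := by
      rw [openConnIn_comm] at h
      exact PlanarDuality.openConnIn_trans h (mem_openConnIn_of_mem_support ξ hξS hξω hz)
    obtain ⟨y, hy, hey⟩ := exists_openConnIn_column_ge hω X (by omega) hzX.le h1
    have hsub : rect L R B T ∩ {z : Site 2 | X ≤ z 0} ⊆ rect X R B T :=
      fun w hw => ⟨hw.2, hw.1.2.1, hw.1.2.2.1, hw.1.2.2.2⟩
    have hey' := openConnIn_mono hsub _ _ hey
    exact ⟨y, Or.inr hy, hey'.2.1, hey'⟩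

/-- Membership in a translate of a set of sites. [folklore] -/
theorem mem_image_shift_iff {v x : Site 2} {A : Set (Site 2)} :
    x ∈ Site.shift v '' A ↔ x - v ∈ A := by
  constructor
  · rintro ⟨y, hy, rfl⟩; simpa using hy
  · intro h; exact ⟨x - v, h, by simp⟩

end KSTPeriodic

end

end Literature.Probability.Percolation
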